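import Literature.AlgebraicGeometry.Resolution.HironakaGroupScheme
import Mathlib.RingTheory.Kaehler.Basic
import Mathlib.Algebra.CharP.Reduced
import HarnessLib

/-!
# Mizutani's conjecture `m(e) = 2p^e − 1` — the subfields `k^{p^e}` and the Frobenius of `k ⊗ k`

Cell topic `Summits/ResolutionOfSingularities/KangarooAtlas` (pub-rosobs); namespace
`Summit.ResolutionOfSingularities.KangarooAtlas.Mizutani`.  Part of the Lean transcription of the
in-house note MIZUTANI-PROOF-g59 (AI-written, AI-audited; *AI review is weaker than expert review*; not a
resolution theorem).  §3 DICTIONARY, infrastructure for the levels `e ↦ e + 1`: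

* the tower of subfields `frobPow k p e = k^{p^e}` of `Literature/…/HironakaGroupScheme.lean`
  (`mem_frobPow_iff`, `frobPow_anti`, `pow_mem_frobPow_succ`);
* for two subfields `K' , K ⊆ k` with `(K')^p ⊆ K`, the **Frobenius of the tensor square**
  `frobTensor : k ⊗_{K'} k →+* k ⊗_K k`, `x ⊗ y ↦ x^p ⊗ y^p` (well defined because `c^p ∈ K` for `c ∈ K'`),
  and `map_frobTensor_ideal_pow_le`: it maps `J'^m` into `J^{pm}` (`J`, `J'` the kernels of multiplication),
  since `x^p ⊗ 1 − 1 ⊗ x^p = (x ⊗ 1 − 1 ⊗ x)^p`.  This is the note's twist `F ⊗ F` (§3 (c)–(d); Oda 1983-II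
  §2 p. 1168 "the p^e-th power Frobenius F^e on F^{-∞}(k) ⊗_k S induces an isomorphism F^{-e}(k) ⊗_k L_0 ≅ L_e").

References: [Oda1983HironakaGroupSchemeII] §2 (p. 1168); [Mizutani1973HironakaGroupSchemes] §1 (c).
-/

open TensorProduct Literature.AlgebraicGeometry.Resolution.HironakaScheme

namespace Summit.ResolutionOfSingularities.KangarooAtlas.Mizutani

universe u

/-! ## The subfields `k^{p^e}` -/

section FrobPow

variable {k : Type u} [Field k] {p : ℕ} [Fact p.Prime] [CharP k p]

/-- Membership in `k^{p^e}`. [cite: Oda1983HironakaGroupSchemeII, §1 (p. 1164: F^e)] -/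
theorem mem_frobPow_iff {e : ℕ} {x : k} : x ∈ frobPow k p e ↔ ∃ y : k, y ^ p ^ e = x := by
  unfold frobPow
  rw [RingHom.mem_fieldRange]
  simp only [iterateFrobenius_def]

/-- `y^{p^e} ∈ k^{p^e}`. [folklore] -/
theorem pow_mem_frobPow (e : ℕ) (y : k) : y ^ p ^ e ∈ frobPow k p e :=
  mem_frobPow_iff.mpr ⟨y, rfl⟩

/-- `k^{p^e} ⊆ k^{p^{e'}}` for `e' ≤ e`. [folklore] -/
theorem frobPow_anti {e e' : ℕ} (h : e' ≤ e) : frobPow k p e ≤ frobPow k p e' := by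
  intro x hx
  obtain ⟨y, rfl⟩ := mem_frobPow_iff.mp hx
  refine mem_frobPow_iff.mpr ⟨y ^ p ^ (e - e'), ?_⟩
  rw [← pow_mul, ← pow_add, Nat.sub_add_cancel h]

/-- `c ∈ k^{p^e} ⇒ c^p ∈ k^{p^{e+1}}`. [folklore] -/
theorem pow_mem_frobPow_succ {e : ℕ} {c : k} (hc : c ∈ frobPow k p e) : c ^ p ∈ frobPow k p (e + 1) := by
  obtain ⟨y, rfl⟩ := mem_frobPow_iff.mp hc
  refine mem_frobPow_iff.mpr ⟨y, ?_⟩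
  rw [pow_succ, pow_mul]

/-- `k^{p^0} = k`. [folklore] -/
theorem mem_frobPow_zero (x : k) : x ∈ frobPow k p 0 :=
  mem_frobPow_iff.mpr ⟨x, by rw [pow_zero, pow_one]⟩

/-- The `p`-th power map of `k` is injective. [folklore] -/
theorem pow_char_injective : Function.Injective fun x : k => x ^ p := by
  intro x y h
  exact frobenius_inj k p (by simpa only [frobenius_def] using h)

/-- The `p^e`-th power map of `k` is injective. [folklore] -/
theorem pow_char_pow_injective (e : ℕ) : Function.Injective fun x : k => x ^ p ^ e := by
  intro x y h
  exact iterateFrobenius_inj k p e (by simpa only [iterateFrobenius_def] using h)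

end FrobPow

/-! ## The Frobenius of the tensor square -/

section FrobTensor

variable {k : Type u} [Field k] {p : ℕ} [Fact p.Prime] [CharP k p] (K' K : Subfield k)
  (hK : ∀ c : k, c ∈ K' → c ^ p ∈ K)

/-- `k ⊗_K k` is nontrivial (it maps onto `k`). [folklore] -/
instance nontrivial_tensor : Nontrivial (k ⊗[K] k) :=
  (Algebra.TensorProduct.lmul' K (S := k)).toRingHom.domain_nontrivial

/-- `k ⊗_K k` has characteristic `p`. [folklore] -/
instance charP_tensor : CharP (k ⊗[K] k) p :=
  charP_of_injective_algebraMap (algebraMap k (k ⊗[K] k)).injective p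

/-- **The Frobenius of the tensor square** `x ⊗ y ↦ x^p ⊗ y^p : k ⊗_{K'} k → k ⊗_K k`, as an additive map
(balanced over `K'` because `(K')^p ⊆ K`). [cite: Oda1983HironakaGroupSchemeII, §2 (p. 1168: the Frobenius F^e on F^{-∞}(k) ⊗_k S)] -/
noncomputable def frobTensorAdd : k ⊗[K'] k →+ k ⊗[K] k :=
  TensorProduct.liftAddHom
    { toFun := fun x =>
        { toFun := fun y => (x ^ p) ⊗ₜ[K] (y ^ p)
          map_zero' := by rw [zero_pow (Fact.out : p.Prime).ne_zero, TensorProduct.tmul_zero]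
          map_add' := fun y y' => by rw [add_pow_char, TensorProduct.tmul_add] }
      map_zero' := by
        ext y
        simp only [AddMonoidHom.coe_mk, ZeroHom.coe_mk, AddMonoidHom.zero_apply]
        rw [zero_pow (Fact.out : p.Prime).ne_zero, TensorProduct.zero_tmul]
      map_add' := fun x x' => by
        ext y
        simp only [AddMonoidHom.coe_mk, ZeroHom.coe_mk, AddMonoidHom.add_apply]
        rw [add_pow_char, TensorProduct.add_tmul] }
    (by
      intro c x y
      simp only [AddMonoidHom.coe_mk, ZeroHom.coe_mk]
      rw [Subfield.smul_def, Subfield.smul_def, smul_eq_mul, smul_eq_mul, mul_pow, mul_pow]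
      have hc : (c : k) ^ p = ((⟨(c : k) ^ p, hK c c.2⟩ : K) : k) := rfl
      rw [hc, ← smul_eq_mul, ← smul_eq_mul, ← Subfield.smul_def, ← Subfield.smul_def, TensorProduct.smul_tmul])

/-- `frobTensorAdd (x ⊗ y) = x^p ⊗ y^p`. [folklore] -/
@[simp] theorem frobTensorAdd_tmul (x y : k) :
    frobTensorAdd K' K hK (x ⊗ₜ[K'] y) = (x ^ p) ⊗ₜ[K] (y ^ p) := by
  unfold frobTensorAdd
  rw [TensorProduct.liftAddHom_tmul]
  rfl

/-- The Frobenius of the tensor square is multiplicative. [folklore] -/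
theorem frobTensorAdd_mul (w w' : k ⊗[K'] k) :
    frobTensorAdd K' K hK (w * w') = frobTensorAdd K' K hK w * frobTensorAdd K' K hK w' := by
  induction w using TensorProduct.induction_on with
  | zero => rw [zero_mul, map_zero, zero_mul]
  | tmul x y =>
    induction w' using TensorProduct.induction_on with
    | zero => rw [mul_zero, map_zero, mul_zero]
    | tmul x' y' =>
      rw [Algebra.TensorProduct.tmul_mul_tmul, frobTensorAdd_tmul, frobTensorAdd_tmul, frobTensorAdd_tmul,
        Algebra.TensorProduct.tmul_mul_tmul, mul_pow, mul_pow]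
    | add a b ha hb => rw [mul_add, map_add, map_add, ha, hb, mul_add]
  | add a b ha hb => rw [add_mul, map_add, map_add, ha, hb, add_mul]

/-- **The Frobenius of the tensor square as a ring homomorphism** `k ⊗_{K'} k → k ⊗_K k`.
[cite: Oda1983HironakaGroupSchemeII, §2 (p. 1168)] -/
noncomputable def frobTensor : k ⊗[K'] k →+* k ⊗[K] k where
  toFun := frobTensorAdd K' K hK
  map_one' := by
    rw [Algebra.TensorProduct.one_def, frobTensorAdd_tmul, one_pow, ← Algebra.TensorProduct.one_def]
  map_mul' := frobTensorAdd_mul K' K hK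
  map_zero' := map_zero _
  map_add' := map_add _

/-- `frobTensor (x ⊗ y) = x^p ⊗ y^p`. [folklore] -/
@[simp] theorem frobTensor_tmul (x y : k) : frobTensor K' K hK (x ⊗ₜ[K'] y) = (x ^ p) ⊗ₜ[K] (y ^ p) :=
  frobTensorAdd_tmul K' K hK x y

/-- The Frobenius maps the diagonal ideal `J'` of `k ⊗_{K'} k` into the `p`-th power of the diagonal ideal
`J` of `k ⊗_K k`: `1 ⊗ s^p − s^p ⊗ 1 = (1 ⊗ s − s ⊗ 1)^p`. [cite: Oda1983HironakaGroupSchemeII, §1 (p. 1165: Δ^{(r)})] -/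
theorem map_frobTensor_ideal_le :
    (KaehlerDifferential.ideal K' k).map (frobTensor K' K hK) ≤ KaehlerDifferential.ideal K k ^ p := by
  rw [← KaehlerDifferential.span_range_eq_ideal K' k, Ideal.map_span, Ideal.span_le]
  rintro _ ⟨_, ⟨s, rfl⟩, rfl⟩
  have : frobTensor K' K hK ((1 : k) ⊗ₜ[K'] s - s ⊗ₜ[K'] 1) = ((1 : k) ⊗ₜ[K] s - s ⊗ₜ[K] 1) ^ p := by
    rw [map_sub, frobTensor_tmul, frobTensor_tmul, one_pow, sub_pow_char, Algebra.TensorProduct.tmul_pow,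
      Algebra.TensorProduct.tmul_pow]
    simp only [one_pow]
  rw [SetLike.mem_coe, this]
  exact Ideal.pow_mem_pow (KaehlerDifferential.one_smul_sub_smul_one_mem_ideal K s) p

/-- **`F ⊗ F` maps `J'^m` into `J^{pm}`.** [cite: Oda1983HironakaGroupSchemeII, §1 (p. 1165)] -/
theorem map_frobTensor_ideal_pow_le (m : ℕ) :
    (KaehlerDifferential.ideal K' k ^ m).map (frobTensor K' K hK) ≤ KaehlerDifferential.ideal K k ^ (p * m) := by
  rw [Ideal.map_pow, pow_mul]
  exact Ideal.pow_right_mono (map_frobTensor_ideal_le K' K hK) m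

/-- Elementwise form: `ρ ∈ J'^m ⇒ (F ⊗ F) ρ ∈ J^{pm}`. [cite: Oda1983HironakaGroupSchemeII, §1 (p. 1165)] -/
theorem frobTensor_mem_ideal_pow {m : ℕ} {ρ : k ⊗[K'] k} (hρ : ρ ∈ KaehlerDifferential.ideal K' k ^ m) :
    frobTensor K' K hK ρ ∈ KaehlerDifferential.ideal K k ^ (p * m) :=
  map_frobTensor_ideal_pow_le K' K hK m (Ideal.mem_map_of_mem _ hρ)

/-- On a sum of pure tensors: `(F ⊗ F)(Σ a_i ⊗ c_i) = Σ a_i^p ⊗ c_i^p`. [folklore] -/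
theorem frobTensor_sum_tmul {ι : Type*} (s : Finset ι) (a c : ι → k) :
    frobTensor K' K hK (∑ i ∈ s, a i ⊗ₜ[K'] c i) = ∑ i ∈ s, (a i ^ p) ⊗ₜ[K] (c i ^ p) := by
  rw [map_sum]
  exact Finset.sum_congr rfl fun i _ => frobTensor_tmul K' K hK (a i) (c i)

end FrobTensor

end Summit.ResolutionOfSingularities.KangarooAtlas.Mizutani
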